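import Summits.Schanuel.Schanuel.Theorems.RootDecomp1ERadixCell07

/-!
# RootDecomp1ERadixCell — lens 2, generation 42 «THE FINITE-ORDER RADIX-2 CELL: count CONJUGATES, not degree» (lanes E-R19 (i) T below hyper + (iii) the transcendental weight log 2): S ITSELF on the pure-radix class {z_l = (v_l·log 2)·T^{e_l}, T real of FIXED finite exponential order} HYPOTHESIS-FREE and on the mixed radix class {z_l = (u_l + v_l log 2)·T^{e_l}} mod the ONE tree fact hX = ExplicitRatExpApprox — the Kummer-direction degree is paid by COUNTING the 𝔐 conjugates of 2^{1/𝔐} through the resultant norm Res_Y(Y^𝔐 − 2, F), never by a pair measure — continuation (RootDecomp1ERadixCell08): §6 items AT the members + separation from the decided classes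

(lens-2 g42 HOME kernel RadixCell.lean d9530aae…, 1851 l, imports tree RootDecomp1EUntwistedWall04 + RootDecomp1KFiniteOrderCell02 only; CLAIM L2067, ACK + CHECKLIST E-g42 L2069, NODE L2089 / REQUEST L2090, critic VERDICT L2095 (crit g8: CLEARED — ONE CELL, tiers 1+2 = one cell; lens-2 tally CELL ×4 (g37, g39, g41, g42); E-R20 closes the radix line; PORT GO `--supports stmt-Schanuel-31410`); port by census-1 gen 18 as `RootDecomp1ERadixCell01`–`08` along K's sections: 01 = §1 the radix field ℚ(2^{1/𝔐}) (`croot`, `zroot`, `broot`, `irreducible_X_pow_sub_two`, degree 𝔐); 02 = §2 the two-level polynomial, conjugate factors `Gfac`, the RESULTANT NORM `resNorm` (`map_resNorm` = ∏ conjugates, `resNorm_ne_zero`, degree / value / Mahler-measure bounds); 03 = §3 the radix curve point `radixPt`, germs, fibres, root and residue avoidance at transcendental parameters; 04 = §4 integral exponents at the collapse (`Mden`, `Aexp`, `Bexp`, the value of G₀, from avoidance to the hypotheses of `resNorm_ne_zero`); 05 = §5 THE PURE-RADIX ENGINE `algebraicIndependent_radixPt_pure` (hypothesis-free, `endgame_pure`)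 + §5b mixed-engine helpers; 06 = §5b THE MIXED ENGINE `algebraicIndependent_radixPt (hX)` (one 320-line theorem, scoped `maxHeartbeats 800000` carried as in K); 07 = §6 classes `InPureRadixClass` / `InRadixClass`, `schanuel_inPureRadixClass` (hyp-free) / `schanuel_inRadixClass (hX)`, cells `cell_31410(_pure)` / `cell_25020(_pure)`, members `zLog2Curve` / `zMix` at tower numbers; 08 = §6 items AT the members + separation (`zMix_not_inPointClass`, `zLog2Curve_not_inPointClass`, `zMix_separation`).
PORT EDITS: 37 one-line docstrings added; five generic helpers made `private` against dedup twins (`mahlerMeasure_finset_prod`, `eval_map_intCast`, `aeval_ne_zero_of_transcendental`, `addNat_eq_natAdd`, `transcendental_log_two` ≡ tree AclSubsetLogFreeCore/Negative) with per-part private copies; statements and proofs verbatim; after the dedup bounce of 05 (p828625: `exists_int_relation` ≡ tree `RootDecomp1BRadicalDescent.exists_int_relation`, RadicalDescent03) K's copy was DELETED and the tree declaration is reused via `import …RootDecomp1BRadicalDescent03` + `open … (exists_int_relation)` in 05/06. `--supports stmt-Schanuel-31410`; no census credit carried; rung 0 — nothing here proves Schanuel.)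
-/

noncomputable section

open Complex Polynomial IntermediateField Filter
open scoped BigOperators Topology

namespace Summit.Schanuel.Schanuel.Theorems.RootDecomp1ERadixCell

open Summit.Schanuel.Schanuel.Theorems.RootDecomp1EUntwistedWall (gι gaussPt expo coef tail fib IsZ wden wden_pos
  isZ_expo Wb Wb_nonneg abs_expo_le abs_coef_le expo_eq_of_tail_eq sum_coef_fibre_cast fib_ne_zero diffPoly
  diffPoly_ne_zero eval_diffPoly gι_expo_sub gι_injective tail_eq_of_expo_eq eq_of_tail_eq_of_zero_eq coef_cast
  IsZ.add IsZ.mul IsZ.natCast IsZ.sum isZ_wden_fst isZ_wden_snd InGaussCurveClass)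
open Summit.Schanuel.Schanuel.Theorems.RootDecomp1EPointTransfer (InPointClass)
open Summit.Schanuel.Schanuel.Theorems.RootDecomp1ETwoScale (InTwoScaleClass)
open Summit.Schanuel.Schanuel.Theorems.RootDecomp1EWallDichotomy (InTwistedFrameClass)
open Summit.Schanuel.Schanuel.Theorems.RootDecomp1KHyper
open Summit.Schanuel.Schanuel.Theorems.RootDecomp1KHyper.HyperCell
open Summit.Schanuel.Schanuel.Theorems.RootDecomp1KGeneric (LiouvilleOrder)
open Summit.Schanuel.Schanuel.Theorems.RootDecomp1KFiniteOrderCell (towerNumber liouvilleOrder_towerNumber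
  not_hyperLiouville_towerNumber towerNumber_pos not_liouvilleOrder_towerNumber)
open Summit.Schanuel.Schanuel.Theorems.RootDecomp1BDefectFloorCells (natCast_le_trdeg_of_algebraicIndependent)

section Cells

variable {n : ℕ}

/-! ### The items AT the members (positional probes; the items themselves stay OPEN) -/

/-- Item 25020's conclusion at the pure member (hypothesis-free). -/
theorem item25020_at_zLog2Curve {n : ℕ} {T : ℝ} (hT0 : 0 < T)
    (hT : LiouvilleOrder ((∑ j : Fin n, ((j : ℕ) + 1)) + 3) T) :
    (n : Cardinal) ≤ Algebra.trdeg ℚ ↥(IntermediateField.adjoin ℚ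
      (Set.range (zLog2Curve n T) ∪ Set.range (Complex.exp ∘ zLog2Curve n T))) + 1 :=
  (schanuel_zLog2Curve hT0 hT).trans le_self_add

/-- Item 25020's conclusion at the mixed member (mod `hX`). -/
theorem item25020_at_zMix (hX : ExplicitRatExpApprox) {k : ℕ} {T : ℝ} (hT0 : 0 < T)
    (hT : LiouvilleOrder (13 * (∑ l, eMix k l) + 4) T) :
    ((k + k : ℕ) : Cardinal) ≤ Algebra.trdeg ℚ ↥(IntermediateField.adjoin ℚ
      (Set.range (zMix k T) ∪ Set.range (Complex.exp ∘ zMix k T))) + 1 :=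
  (schanuel_zMix hX hT0 hT).trans le_self_add

/-- Item 31410's conclusion at the pure member (hypothesis-free; 31410 and 25020 share their conclusion, the
no-stabiliser / first-failure binders of 31410 are simply not needed on the class). -/
theorem item31410_at_zLog2Curve {n : ℕ} {T : ℝ} (hT0 : 0 < T)
    (hT : LiouvilleOrder ((∑ j : Fin n, ((j : ℕ) + 1)) + 3) T) :
    (n : Cardinal) ≤ Algebra.trdeg ℚ ↥(IntermediateField.adjoin ℚ
      (Set.range (zLog2Curve n T) ∪ Set.range (Complex.exp ∘ zLog2Curve n T))) + 1 :=
  item25020_at_zLog2Curve hT0 hT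

/-- Item 31410's conclusion at the mixed member (mod `hX`). -/
theorem item31410_at_zMix (hX : ExplicitRatExpApprox) {k : ℕ} {T : ℝ} (hT0 : 0 < T)
    (hT : LiouvilleOrder (13 * (∑ l, eMix k l) + 4) T) :
    ((k + k : ℕ) : Cardinal) ≤ Algebra.trdeg ℚ ↥(IntermediateField.adjoin ℚ
      (Set.range (zMix k T) ∪ Set.range (Complex.exp ∘ zMix k T))) + 1 :=
  item25020_at_zMix hX hT0 hT

/-! ### Separation of the members from the lineage's decided classes (hypothesis-free where cheap) -/

/-- **`log 2` is transcendental** (Hermite–Lindemann, PROVED in the tree: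
`Literature.NumberTheory.Transcendental.transcendental_exp_holds`; `e^{log 2} = 2`). -/
private theorem transcendental_log_two : Transcendental ℚ ((Real.log 2 : ℝ) : ℂ) := by
  intro halg
  have hne : ((Real.log 2 : ℝ) : ℂ) ≠ 0 := by
    have : Real.log 2 ≠ 0 := (Real.log_pos (by norm_num)).ne'
    exact_mod_cast this
  have htr := Literature.NumberTheory.Transcendental.transcendental_exp_holds halg hne
  apply htr
  have hexp : Complex.exp ((Real.log 2 : ℝ) : ℂ) = (2 : ℂ) := by
    rw [← Complex.ofReal_exp, Real.exp_log (by norm_num)]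
    norm_num
  rw [hexp]
  have h2 : IsAlgebraic ℚ (algebraMap ℚ ℂ 2) := isAlgebraic_algebraMap 2
  rwa [map_ofNat] at h2

/-- **THE WEIGHTS ARE OUTSIDE g41's WEIGHT RING `ℚ(i)`**: `v·log 2 ∉ ℚ(i)` for `v ≠ 0` — so no member with a
`log 2`-weight present is a `gaussPt` with Gaussian-rational weights ALONG THE SAME `T` (E-R19 (iii): a second,
transcendental scale). -/
theorem ρι_ne_gι {v : ℚ} (hv : v ≠ 0) (u : ℚ) (w : ℚ × ℚ) : ρι (u, v) ≠ gι w := by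
  intro h
  have hre : ρr (u, v) = (gι w).re := by
    have := congrArg Complex.re h; rwa [ρι, Complex.ofReal_re] at this
  have hre' : (u : ℝ) + v * Real.log 2 = w.1 := by
    rw [ρr] at hre; rw [hre, gι]; simp
  -- so `log 2 = (w.1 - u)/v ∈ ℚ`: contradicts transcendence
  have hlog : ((Real.log 2 : ℝ) : ℂ) = (((w.1 - u) / v : ℚ) : ℂ) := by
    have hv' : (v : ℝ) ≠ 0 := by exact_mod_cast hv
    have : Real.log 2 = ((w.1 : ℝ) - u) / v := by
      rw [eq_div_iff hv']; linarith
    rw [this]; push_cast; ring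
  exact transcendental_log_two (by rw [hlog]; exact isAlgebraic_algebraMap _)

/-- **The mixed member is NOT in the point class** `InPointClass` (g36, tree name
`RootDecomp1EPointTransfer.InPointClass`: `z = ρ·y`, `y` algebraic): the ratio `z_{k}/z_0 = log 2` would be
algebraic.  Hypothesis-free (any `T ≠ 0`, `k ≥ 1`). -/
theorem zMix_not_inPointClass {k : ℕ} (hk : 0 < k) {T : ℝ} (hT0 : T ≠ 0) : ¬ InPointClass (zMix k T) := by
  rintro ⟨ρ, y, -, hy, -, hz⟩
  set j₀ : Fin k := ⟨0, hk⟩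
  have ha := congrFun hz (Fin.castAdd k j₀)
  have hb := congrFun hz (Fin.natAdd k j₀)
  rw [zMix_left] at ha
  rw [zMix_right, ha] at hb
  -- `ha : T^1 = ρ y_a`, `hb : log 2 · (ρ y_a) = ρ y_b`
  have hT1 : (T : ℂ) ^ ((j₀ : ℕ) + 1) ≠ 0 := pow_ne_zero _ (by exact_mod_cast hT0)
  have hρ : (ρ : ℂ) ≠ 0 := by intro h; rw [h, zero_mul] at ha; exact hT1 ha
  have hya : y (Fin.castAdd k j₀) ≠ 0 := by intro h; rw [h, mul_zero] at ha; exact hT1 ha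
  have hlog : ((Real.log 2 : ℝ) : ℂ) = y (Fin.natAdd k j₀) * (y (Fin.castAdd k j₀))⁻¹ := by
    have : (ρ : ℂ) * (((Real.log 2 : ℝ) : ℂ) * y (Fin.castAdd k j₀) - y (Fin.natAdd k j₀)) = 0 := by
      rw [mul_sub, ← hb]; ring
    have h2 : ((Real.log 2 : ℝ) : ℂ) * y (Fin.castAdd k j₀) = y (Fin.natAdd k j₀) := by
      have := (mul_eq_zero.mp this).resolve_left hρ
      exact sub_eq_zero.mp this
    rw [← h2, mul_assoc, mul_inv_cancel₀ hya, mul_one]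
  exact transcendental_log_two (by rw [hlog]; exact (hy _).mul (hy _).inv)

/-- **The pure member is NOT in the point class** either (`n ≥ 2`, `T` transcendental, e.g. of exponential
order `≥ 3`): `z_1/z_0 = T` would be algebraic. -/
theorem zLog2Curve_not_inPointClass {n : ℕ} (hn : 2 ≤ n) {T : ℝ} (hT : Transcendental ℚ T) (hT0 : T ≠ 0) :
    ¬ InPointClass (zLog2Curve n T) := by
  rintro ⟨ρ, y, -, hy, -, hz⟩
  have ha := congrFun hz ⟨0, by omega⟩
  have hb := congrFun hz ⟨1, by omega⟩
  simp only [zLog2Curve_apply] at ha hb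
  -- `ha : log2 · T^1 = ρ y₀`, `hb : log2 · T^2 = ρ y₁`
  have hl : ((Real.log 2 : ℝ) : ℂ) ≠ 0 := by
    have : Real.log 2 ≠ 0 := (Real.log_pos (by norm_num)).ne'
    exact_mod_cast this
  have hTC : (T : ℂ) ≠ 0 := by exact_mod_cast hT0
  have hρ : (ρ : ℂ) ≠ 0 := by
    intro h; rw [h, zero_mul] at ha; exact (mul_ne_zero hl (pow_ne_zero _ hTC)) ha
  have hy0 : y ⟨0, by omega⟩ ≠ 0 := by
    intro h; rw [h, mul_zero] at ha; exact (mul_ne_zero hl (pow_ne_zero _ hTC)) ha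
  have hTeq : (T : ℂ) = y ⟨1, by omega⟩ * (y ⟨0, by omega⟩)⁻¹ := by
    have h1 : (ρ : ℂ) * y ⟨1, by omega⟩ = (T : ℂ) * ((ρ : ℂ) * y ⟨0, by omega⟩) := by
      rw [← ha, ← hb]; ring
    have h2 : y ⟨1, by omega⟩ = (T : ℂ) * y ⟨0, by omega⟩ := by
      have : (ρ : ℂ) * (y ⟨1, by omega⟩ - (T : ℂ) * y ⟨0, by omega⟩) = 0 := by rw [mul_sub, h1]; ring
      exact sub_eq_zero.mp ((mul_eq_zero.mp this).resolve_left hρ)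
    rw [h2, mul_assoc, mul_inv_cancel₀ hy0, mul_one]
  have halg : IsAlgebraic ℚ (T : ℂ) := by rw [hTeq]; exact (hy _).mul (hy _).inv
  exact ((transcendental_algebraMap_iff (algebraMap ℝ ℂ).injective).mpr hT) halg

/-- **SEPARATION SUMMARY at the named mixed member** (hypothesis-free): the parameter is NOT hyper-Liouville
(tree `not_hyperLiouville_towerNumber`) — so the member is outside every HYPER-Liouville cell of the lineage ALONG
ITS OWN PARAMETER (g41 `InGaussCurveClass`, 1K Kummer/log cells `hyperCell_ratLog2_any`/`sb_kummer_of_mem`, which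
moreover carry `hNW`) — its `log 2`-weights are outside `ℚ(i)` (`ρι_ne_gι`), and it is not in `InPointClass`.
Membership of the member in `InScaleClass`/`InLWClass`/`InTwistedFrameClass`/`InGaussCurveClass` through some OTHER
parameter is an open Diophantine question about tower numbers, NOT claimed either way. -/
theorem zMix_separation {k : ℕ} (hk : 0 < k) (c : ℕ) (hc : 2 ≤ c) :
    ¬ HyperLiouville (towerNumber c) ∧ ¬ InPointClass (zMix k (towerNumber c)) ∧
      (∀ (v : ℚ), v ≠ 0 → ∀ (u : ℚ) (w : ℚ × ℚ), ρι (u, v) ≠ gι w) :=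
  ⟨not_hyperLiouville_towerNumber hc, zMix_not_inPointClass hk (towerNumber_pos (by omega)).ne',
    fun _ hv u w => ρι_ne_gι hv u w⟩

end Cells

end Summit.Schanuel.Schanuel.Theorems.RootDecomp1ERadixCell

end
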